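import Literature.Barriers.NavierStokesRegularity.NavierStokesInequalityStructureCopies
import Mathlib.NumberTheory.ZetaValues
import HarnessLib

/-!
# The background copy (Lemma 5.3/13) and the far copies (Lemma 6.18) of Scheffer's arrangement

Barrier catalogue support file for `NavierStokesRegularity` (D-0021), on the discharge path of
fact C′ `Literature.Barriers.NavierStokesRegularity.NSICantorArrangementExists` of
`NavierStokesInequalityCantorArrangement` (W. S. Ożański, arXiv:1709.00602v4, §5.4 and §6.5).
Two estimates of the construction that are pure real analysis on a planar vector function, kept
free of structures so that they elaborate quickly:

* **Lemma 5.3** (held text: Lemma 13) — the background copy `U^{a,r}`, `a = -κr/ε`,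
  `s²/r = 1.04 n⁴B/D`, `n = κ/ε`: on `BOX` its interaction function `F^{a,r,s} = (s²/r)F∘copyInv`
  has `1.03B ≤ F₁^{a,r,s} ≤ 1.05B` and `|F₂^{a,r,s}| ≤ 34 (C/D)(ε/κ) B` (printed: `≤ 0.01εB` for
  `κ = 10⁴C/D`; here for every `κ ≥ 1`), from Lemma 3.5 (v), (iv), (iii) supplied as hypotheses
  (`background_snd_mem`, `background_fst_le`);
* **Lemma 6.18 and §6.5 Step 2 (i)–(ii), Step 4 Case 2** — for `H* = Σ_{n<M} H(· - nX)`: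
  the tail bound `Σ_{n≠k} |H(x₁-nX,x₂)| ≤ 0.01B` when `X⁴ ≥ 10600 C/B` (`tail_sum_le`, via
  `Σ_{j∈ℤ∖0} j⁻² = π²/3`), whence `H*₁ ≥ -1.02B` on the strip, `H*₁ ≥ 6.98B` on the boxes
  `SBOX_m`, and `|H*| ≤ 2·10⁴ C M/r⁴` at distance `≥ r/10` from the axis pieces
  (`hstar_snd_ge_strip`, `hstar_snd_ge_box`, `norm_hstar_le`).

Tree coordinates as in the sibling files (`q = (r, z)`, Ożański's `F₁ = (F q).2`, sup norm).

## References

* W. S. Ożański, arXiv:1709.00602v4 (2017/2019), Lemma 5.3 (proof), §5.4 (5.27) Case 2,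
  Lemma 6.18, §6.5 Step 2 (i)–(ii), Step 4 Case 2. [`Ozanski2017NSISingular`]
* V. Scheffer, Comm. Math. Phys. 110 (1987), 525–551, §4 (Lemmas 4.7–4.18). [`Scheffer1987`]
-/

noncomputable section

open MeasureTheory Set Function Filter Topology TopologicalSpace Metric Real Finset
open scoped InnerProductSpace RealInnerProductSpace ContDiff

namespace Literature.Barriers.NavierStokesRegularity

/-! ### Lemma 5.3 (13): the background copy on `BOX` -/

section Background

variable {F : ℝ × ℝ → ℝ × ℝ}

/-- **Lemma 5.3 (13), axial part** (Ożański 2017): with `n = κ/ε ≥ N` and Lemma 3.5 (v) (half-width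
`κ + 1`, tolerance `D/1000`) for `F`, the background interaction function
`(s²/r) F(r'/r, z/r + n)` (`s²/r = 1.04 n⁴ B/D`) lies in `[1.03B, 1.05B]` for `0 ≤ r' ≤ 0.99r`,
`|z| ≤ κr`. [cite: Ozanski2017NSISingular, Lemma 5.3 (first half)] -/
theorem background_snd_mem {B D κ ε r N : ℝ} (hB : 0 < B) (hD : 0 < D) (hκ : 0 < κ) (hε : 0 < ε)
    (hr : 0 < r)
    (hN : ∀ n : ℝ, N ≤ n → ∀ q : ℝ × ℝ, |q.1| < 1 → |q.2 - n| < κ + 1 →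
      |(F q).2 - D / n ^ 4| ≤ D / 1000 / n ^ 4)
    (hNε : N ≤ κ / ε) {q : ℝ × ℝ} (hq₁ : 0 ≤ q.1) (hq₂ : q.1 ≤ 99 / 100 * r) (hq₃ : |q.2| ≤ κ * r) :
    (104 / 100 * (κ / ε) ^ 4 * B / D * (F (copyInv (-(κ * r / ε)) r q)).2) ∈
      Icc (103 / 100 * B) (105 / 100 * B) := by
  set n : ℝ := κ / ε with hn
  have hnpos : 0 < n := by positivity
  have hp : copyInv (-(κ * r / ε)) r q = (q.1 / r, q.2 / r + n) := by
    simp only [copyInv_apply, hn, Prod.mk.injEq, true_and]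
    field_simp; ring
  have h1 : |(copyInv (-(κ * r / ε)) r q).1| < 1 := by
    rw [hp, abs_div, abs_of_nonneg hq₁, abs_of_pos hr, div_lt_one hr]; linarith
  have h2 : |(copyInv (-(κ * r / ε)) r q).2 - n| < κ + 1 := by
    rw [hp]
    simp only [add_sub_cancel_right]
    rw [abs_div, abs_of_pos hr, div_lt_iff₀ hr]; nlinarith
  have key := hN n hNε _ h1 h2
  have hn4 : 0 < n ^ 4 := by positivity
  rw [abs_le] at key
  set G := (F (copyInv (-(κ * r / ε)) r q)).2 with hG
  have lo : D / n ^ 4 - D / 1000 / n ^ 4 ≤ G := by linarith [key.1]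
  have hi : G ≤ D / n ^ 4 + D / 1000 / n ^ 4 := by linarith [key.2]
  have e : 104 / 100 * n ^ 4 * B / D * (D / n ^ 4) = 104 / 100 * B := by field_simp
  have e' : 104 / 100 * n ^ 4 * B / D * (D / 1000 / n ^ 4) = 104 / 100000 * B := by field_simp; ring
  have hc : 0 ≤ 104 / 100 * n ^ 4 * B / D := by positivity
  constructor
  · have := mul_le_mul_of_nonneg_left lo hc
    rw [mul_sub, e, e'] at this
    linarith
  · have := mul_le_mul_of_nonneg_left hi hc
    rw [mul_add, e, e'] at this
    linarith

/-- **Lemma 5.3 (13), radial part**: with Lemma 3.5 (iv) (`F₂ = 0` on the axis) and (iii)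
(`|∇F| ≤ C/|q|⁵`), `|(s²/r) F₂(r'/r, z/r + n)| ≤ 34 (C/D)(ε/κ) B` on the same box (`ε ≤ 1/2`; printed
with `32 · 1.04`). The mean value theorem from the axis, where the segment stays at distance
`≥ n - κ ≥ n/2` from the origin. [cite: Ozanski2017NSISingular, Lemma 5.3 (second half)] -/
theorem background_fst_le {B C D κ ε r : ℝ} (hB : 0 < B) (hC : 0 ≤ C) (hD : 0 < D) (hκ : 0 < κ)
    (hε : 0 < ε) (hε2 : ε ≤ 1 / 2) (hr : 0 < r) (hFd : Differentiable ℝ F)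
    (hdec : ∀ q : ℝ × ℝ, q ≠ 0 → ‖fderiv ℝ F q‖ ≤ C / ‖q‖ ^ 5) (haxis : ∀ t : ℝ, (F (0, t)).1 = 0)
    {q : ℝ × ℝ} (hq₁ : 0 ≤ q.1) (hq₂ : q.1 ≤ 99 / 100 * r) (hq₃ : |q.2| ≤ κ * r) :
    |104 / 100 * (κ / ε) ^ 4 * B / D * (F (copyInv (-(κ * r / ε)) r q)).1| ≤
      34 * (C / D) * (ε / κ) * B := by
  set n : ℝ := κ / ε with hn
  have hnpos : 0 < n := by positivity
  have hnκ : 2 * κ ≤ n := by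
    rw [hn, le_div_iff₀ hε]; nlinarith
  set p := copyInv (-(κ * r / ε)) r q with hpdef
  have hp : p = (q.1 / r, q.2 / r + n) := by
    simp only [hpdef, copyInv_apply, hn, Prod.mk.injEq, true_and]
    field_simp; ring
  have hp1 : 0 ≤ p.1 ∧ p.1 ≤ 1 := by
    rw [hp]; exact ⟨div_nonneg hq₁ hr.le, by rw [div_le_one hr]; linarith⟩
  have hp2 : n / 2 ≤ |p.2| := by
    rw [hp]
    simp only
    have h1 : |q.2 / r| ≤ κ := by rw [abs_div, abs_of_pos hr, div_le_iff₀ hr]; exact hq₃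
    have h2 : |q.2 / r + n| ≥ |n| - |q.2 / r| := by
      have := abs_add_le (q.2 / r + n) (-(q.2 / r)); rw [abs_neg] at this
      have e : q.2 / r + n + -(q.2 / r) = n := by ring
      rw [e] at this; linarith
    rw [abs_of_pos hnpos] at h2
    linarith
  -- the mean value theorem on the horizontal segment from the axis point `(0, p.2)` to `p`
  have hconv : Convex ℝ (Icc (0 : ℝ) 1 ×ˢ ({p.2} : Set ℝ)) := (convex_Icc _ _).prod (convex_singleton _)
  have hbound : ∀ w ∈ Icc (0 : ℝ) 1 ×ˢ ({p.2} : Set ℝ), ‖fderiv ℝ F w‖ ≤ C / (n / 2) ^ 5 := by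
    rintro w ⟨-, hw2⟩
    rw [mem_singleton_iff] at hw2
    have hwn : n / 2 ≤ ‖w‖ := by
      calc n / 2 ≤ |p.2| := hp2
        _ = |w.2| := by rw [hw2]
        _ ≤ ‖w‖ := by rw [← Real.norm_eq_abs]; exact norm_snd_le w
    have hw0 : w ≠ 0 := by
      intro h0; rw [h0, norm_zero] at hwn; linarith
    refine (hdec w hw0).trans ?_
    exact div_le_div_of_nonneg_left hC (by positivity) (pow_le_pow_left₀ (by positivity) hwn 5)
  have hpmem : p ∈ Icc (0 : ℝ) 1 ×ˢ ({p.2} : Set ℝ) := ⟨hp1, rfl⟩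
  have h0mem : ((0 : ℝ), p.2) ∈ Icc (0 : ℝ) 1 ×ˢ ({p.2} : Set ℝ) := ⟨⟨le_rfl, zero_le_one⟩, rfl⟩
  have hmvt := hconv.norm_image_sub_le_of_norm_fderiv_le (fun w _ => (hFd w)) hbound h0mem hpmem
  have hdist : ‖p - ((0 : ℝ), p.2)‖ = |p.1| := by
    rw [Prod.norm_def]; simp
  rw [hdist, abs_of_nonneg hp1.1] at hmvt
  have hF1 : |(F p).1| ≤ C / (n / 2) ^ 5 := by
    calc |(F p).1| = ‖(F p - F (0, p.2)).1‖ := by simp [haxis, Real.norm_eq_abs]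
      _ ≤ ‖F p - F (0, p.2)‖ := norm_fst_le _
      _ ≤ C / (n / 2) ^ 5 * p.1 := hmvt
      _ ≤ C / (n / 2) ^ 5 * 1 := mul_le_mul_of_nonneg_left hp1.2 (by positivity)
      _ = C / (n / 2) ^ 5 := mul_one _
  rw [abs_mul, abs_of_pos (by positivity : (0 : ℝ) < 104 / 100 * n ^ 4 * B / D)]
  calc 104 / 100 * n ^ 4 * B / D * |(F p).1| ≤ 104 / 100 * n ^ 4 * B / D * (C / (n / 2) ^ 5) :=
        mul_le_mul_of_nonneg_left hF1 (by positivity)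
    _ = (104 * 32 / 100) * (C / D) * B / n := by field_simp; ring
    _ ≤ 34 * (C / D) * B / n := by
        refine div_le_div_of_nonneg_right ?_ hnpos.le
        nlinarith [div_nonneg hC hD.le, mul_nonneg (div_nonneg hC hD.le) hB.le]
    _ = 34 * (C / D) * (ε / κ) * B := by rw [hn]; field_simp

end Background

/-! ### Lemma 6.18: the far copies and `H* = Σ_{n<M} H(· - nX)` -/

/-- **`H*(q) = Σ_{n<M} H(r, z - nX)`** — the joint pressure interaction function of the `M`
translated clusters (Ożański 2017, §6.5 Step 2, (6.34)). [cite: Ozanski2017NSISingular, §6.5 Step 2] -/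
def hstar (Hc : ℝ × ℝ → ℝ × ℝ) (M : ℕ) (X : ℝ) (q : ℝ × ℝ) : ℝ × ℝ :=
  ∑ n ∈ Finset.range M, Hc (q.1, q.2 - n * X)

section Tail

variable {Hc : ℝ × ℝ → ℝ × ℝ}

/-- `Σ_{j ∈ ℤ} 1/j² = π²/3` (the term `j = 0` is Lean's `1/0 = 0`). [folklore] -/
theorem hasSum_int_inv_sq : HasSum (fun j : ℤ => 1 / (j : ℝ) ^ 2) (π ^ 2 / 6 + π ^ 2 / 6) := by
  refine HasSum.of_nat_of_neg_add_one ?_ ?_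
  · simpa using hasSum_zeta_two
  · have h0 := hasSum_zeta_two
    have h1 : HasSum (fun n : ℕ => (1 : ℝ) / ((n + 1 : ℕ) : ℝ) ^ 2) (π ^ 2 / 6) :=
      (hasSum_nat_add_iff (f := fun n : ℕ => (1 : ℝ) / (n : ℝ) ^ 2) 1).2 (by simpa using h0)
    convert h1 using 1
    funext n
    push_cast
    ring

/-- **Lemma 6.18** (Ożański 2017: "`Σ_{n≠k} |H(x₁-nX,x₂)| < 0.01B`"): if `|H(q)| ≤ 2C/|q|⁴` for
`|q| ≥ 2|A|`, `X ≥ 4|A|`, `X ≥ 1` and `X⁴ ≥ 10600 C/B`, then for every integer `k` and every `q`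
with `|z - nX| ≥ (|n-k| - 1/2)X` for `n ≠ k`, `Σ_{n<M, n≠k} |H(r, z - nX)| ≤ B/100` (printed with the
series `Σ(|k|-1/2)⁻⁴`; here bounded through `(j-1/2)⁻⁴ ≤ 16 j⁻⁴ ≤ 16 j⁻²` and `Σ_{j≠0} j⁻² = π²/3`).
[cite: Ozanski2017NSISingular, Lemma 6.18] -/
theorem tail_sum_le {A B C X : ℝ} (hB : 0 < B) (hC : 0 ≤ C) (hXA : 4 * |A| ≤ X) (hX1 : 1 ≤ X)
    (hXt : 10600 * C / B ≤ X ^ 4) (hdec : ∀ q : ℝ × ℝ, 2 * |A| ≤ ‖q‖ → ‖Hc q‖ ≤ 2 * C / ‖q‖ ^ 4)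
    (M : ℕ) (k : ℤ) (q : ℝ × ℝ)
    (hsep : ∀ n ∈ Finset.range M, (n : ℤ) ≠ k → (|(n : ℝ) - k| - 1 / 2) * X ≤ |q.2 - n * X|) :
    ∑ n ∈ (Finset.range M).filter (fun n : ℕ => (n : ℤ) ≠ k), ‖Hc (q.1, q.2 - n * X)‖ ≤ B / 100 := by
  have hX : 0 < X := by linarith
  set ψ : ℤ → ℝ := fun j => 1 / (j : ℝ) ^ 2 with hψ
  have hψ0 : ∀ j, 0 ≤ ψ j := fun j => by positivity
  -- termwise bound: `‖H(r, z - nX)‖ ≤ (32C/X⁴) ψ(n - k)`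
  have hterm : ∀ n ∈ (Finset.range M).filter (fun n : ℕ => (n : ℤ) ≠ k),
      ‖Hc (q.1, q.2 - n * X)‖ ≤ 32 * C / X ^ 4 * ψ ((n : ℤ) - k) := by
    intro n hn
    rw [Finset.mem_filter] at hn
    have hj1 : 1 ≤ |((n : ℤ) - k : ℤ)| := Int.one_le_abs (sub_ne_zero.2 hn.2)
    have hj1' : (1 : ℝ) ≤ |(n : ℝ) - k| := by exact_mod_cast hj1
    have hsep' := hsep n hn.1 hn.2
    set j : ℝ := |(n : ℝ) - k| with hjdef
    have hjX : X / 2 ≤ (j - 1 / 2) * X := by nlinarith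
    have hnorm : (j - 1 / 2) * X ≤ ‖(q.1, q.2 - n * X)‖ :=
      hsep'.trans (by rw [← Real.norm_eq_abs]; exact norm_snd_le (q.1, q.2 - ↑n * X))
    have h2A : 2 * |A| ≤ ‖(q.1, q.2 - n * X)‖ := by linarith
    have hpos : 0 < (j - 1 / 2) * X := by nlinarith
    calc ‖Hc (q.1, q.2 - n * X)‖ ≤ 2 * C / ‖(q.1, q.2 - n * X)‖ ^ 4 := hdec _ h2A
      _ ≤ 2 * C / ((j - 1 / 2) * X) ^ 4 :=
          div_le_div_of_nonneg_left (by positivity) (by positivity) (pow_le_pow_left₀ hpos.le hnorm 4)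
      _ ≤ 2 * C / ((j / 2) * X) ^ 4 := by
          refine div_le_div_of_nonneg_left (by positivity) (by positivity) ?_
          exact pow_le_pow_left₀ (by positivity) (by nlinarith) 4
      _ = 32 * C / X ^ 4 * (1 / j ^ 4) := by field_simp; ring
      _ ≤ 32 * C / X ^ 4 * (1 / j ^ 2) := by
          refine mul_le_mul_of_nonneg_left ?_ (by positivity)
          refine div_le_div_of_nonneg_left zero_le_one (by positivity) ?_
          nlinarith [pow_le_pow_right₀ hj1' (by norm_num : 2 ≤ 4)]
      _ = 32 * C / X ^ 4 * ψ ((n : ℤ) - k) := by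
          simp only [hψ, hjdef, Int.cast_sub, Int.cast_natCast, sq_abs]
  -- sum of `ψ` over the (injective) image is at most the full series
  have hinj : Set.InjOn (fun n : ℕ => (n : ℤ) - k) ((Finset.range M).filter fun n : ℕ => (n : ℤ) ≠ k) := by
    intro a _ b _ hab
    have : (a : ℤ) = b := by simpa using hab
    exact_mod_cast this
  have hsumψ : ∑ n ∈ (Finset.range M).filter (fun n : ℕ => (n : ℤ) ≠ k), ψ ((n : ℤ) - k) ≤ π ^ 2 / 6 + π ^ 2 / 6 := by
    rw [← Finset.sum_image hinj]
    exact sum_le_hasSum _ (fun j _ => hψ0 j) hasSum_int_inv_sq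
  have hπ : π ^ 2 / 6 + π ^ 2 / 6 ≤ 331 / 100 := by
    have := Real.pi_lt_d2
    nlinarith [Real.pi_pos]
  calc ∑ n ∈ (Finset.range M).filter (fun n : ℕ => (n : ℤ) ≠ k), ‖Hc (q.1, q.2 - n * X)‖
      ≤ ∑ n ∈ (Finset.range M).filter (fun n : ℕ => (n : ℤ) ≠ k), 32 * C / X ^ 4 * ψ ((n : ℤ) - k) :=
        Finset.sum_le_sum hterm
    _ = 32 * C / X ^ 4 * ∑ n ∈ (Finset.range M).filter (fun n : ℕ => (n : ℤ) ≠ k), ψ ((n : ℤ) - k) := by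
        rw [Finset.mul_sum]
    _ ≤ 32 * C / X ^ 4 * (331 / 100) :=
        mul_le_mul_of_nonneg_left (hsumψ.trans hπ) (by positivity)
    _ = (32 * 331 / 100) * C / X ^ 4 := by ring
    _ ≤ B / 100 := by
        rw [div_le_div_iff₀ (by positivity) (by norm_num)]
        have := (div_le_iff₀ hB).1 hXt
        nlinarith

/-- The second component of `H*` is the sum of the second components. [folklore] -/
theorem hstar_snd (Hc : ℝ × ℝ → ℝ × ℝ) (M : ℕ) (X : ℝ) (q : ℝ × ℝ) :
    (hstar Hc M X q).2 = ∑ n ∈ Finset.range M, (Hc (q.1, q.2 - n * X)).2 := by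
  simp [hstar, Prod.snd_sum]

/-- **§6.5 Step 2 (i): `H*₁ ≥ -1.02B` on the strip** `{0 ≤ r < E}` (from (v) of the stack,
`H₁ ≥ -1.01B` there, and Lemma 6.18 for the other clusters, `k` the nearest one).
[cite: Ozanski2017NSISingular, §6.5 Step 2 (i)] -/
theorem hstar_snd_ge_strip {A B C X E : ℝ} (hB : 0 < B) (hC : 0 ≤ C) (hXA : 4 * |A| ≤ X)
    (hX1 : 1 ≤ X) (hXt : 10600 * C / B ≤ X ^ 4)
    (hdec : ∀ q : ℝ × ℝ, 2 * |A| ≤ ‖q‖ → ‖Hc q‖ ≤ 2 * C / ‖q‖ ^ 4)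
    (hv : ∀ p : ℝ × ℝ, 0 ≤ p.1 → p.1 < E → -(101 / 100) * B ≤ (Hc p).2) (M : ℕ) {q : ℝ × ℝ}
    (hq0 : 0 ≤ q.1) (hqE : q.1 < E) : -(102 / 100) * B ≤ (hstar Hc M X q).2 := by
  have hX : 0 < X := by linarith
  set k : ℤ := round (q.2 / X) with hk
  have hkq : |q.2 - k * X| ≤ X / 2 := by
    have h := abs_sub_round (q.2 / X)
    rw [← hk] at h
    have : q.2 - k * X = (q.2 / X - k) * X := by field_simp
    rw [this, abs_mul, abs_of_pos hX]
    nlinarith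
  have hsep : ∀ n ∈ Finset.range M, (n : ℤ) ≠ k → (|(n : ℝ) - k| - 1 / 2) * X ≤ |q.2 - n * X| := by
    intro n _ _
    have e : q.2 - n * X = (q.2 - k * X) + ((k : ℝ) - n) * X := by ring
    have h1 : |((k : ℝ) - n) * X| - |q.2 - k * X| ≤ |q.2 - n * X| := by
      rw [e]
      have := abs_add_le ((q.2 - ↑k * X) + (↑k - ↑n) * X) (-(q.2 - ↑k * X))
      rw [abs_neg, add_neg_cancel_comm] at this
      linarith
    rw [abs_mul, abs_of_pos hX, abs_sub_comm] at h1
    nlinarith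
  have htail := tail_sum_le hB hC hXA hX1 hXt hdec M k q hsep
  rw [hstar_snd, ← Finset.sum_filter_add_sum_filter_not (Finset.range M) (fun n : ℕ => (n : ℤ) = k)]
  -- the cluster `n = k` (at most one term), each `≥ -1.01B`
  have hcard : ((Finset.range M).filter (fun n : ℕ => (n : ℤ) = k)).card ≤ 1 :=
    Finset.card_le_one.2 fun a ha b hb => by
      rw [Finset.mem_filter] at ha hb
      exact_mod_cast ha.2.trans hb.2.symm
  have h1 : ((Finset.range M).filter (fun n : ℕ => (n : ℤ) = k)).card • (-(101 / 100) * B) ≤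
      ∑ n ∈ (Finset.range M).filter (fun n : ℕ => (n : ℤ) = k), (Hc (q.1, q.2 - n * X)).2 :=
    Finset.card_nsmul_le_sum _ _ _ fun n _ => hv _ hq0 hqE
  have h1' : -(101 / 100) * B ≤ ∑ n ∈ (Finset.range M).filter (fun n : ℕ => (n : ℤ) = k), (Hc (q.1, q.2 - n * X)).2 := by
    refine le_trans ?_ h1
    rw [nsmul_eq_mul]
    rcases Nat.le_one_iff_eq_zero_or_eq_one.1 hcard with hc | hc
    · rw [hc]; norm_num; linarith
    · rw [hc]; norm_num
  -- the other clusters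
  have h2 : -(B / 100) ≤ ∑ n ∈ (Finset.range M).filter (fun n : ℕ => ¬((n : ℤ) = k)), (Hc (q.1, q.2 - n * X)).2 := by
    have : ∑ n ∈ (Finset.range M).filter (fun n : ℕ => ¬((n : ℤ) = k)), -‖Hc (q.1, q.2 - n * X)‖ ≤
        ∑ n ∈ (Finset.range M).filter (fun n : ℕ => ¬((n : ℤ) = k)), (Hc (q.1, q.2 - n * X)).2 :=
      Finset.sum_le_sum fun n _ => by
        have := norm_snd_le (Hc (q.1, q.2 - ↑n * X)); rw [Real.norm_eq_abs] at this
        linarith [neg_abs_le (Hc (q.1, q.2 - ↑n * X)).2]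
    rw [Finset.sum_neg_distrib] at this
    linarith
  linarith

/-- **§6.5 Step 2 (ii): `H*₁ ≥ 6.98B` on the boxes** `{|z - A - mX| ≤ κE, 0 ≤ r < E}`, `m < M`
(from (vi) of the stack and Lemma 6.18, with `X ≥ 2|A| + 2κE`).
[cite: Ozanski2017NSISingular, §6.5 Step 2 (ii)] -/
theorem hstar_snd_ge_box {A B C X E κ : ℝ} (hB : 0 < B) (hC : 0 ≤ C) (hXA : 4 * |A| ≤ X)
    (hX1 : 1 ≤ X) (hXt : 10600 * C / B ≤ X ^ 4) (hXκ : 2 * |A| + 2 * (κ * E) ≤ X)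
    (hdec : ∀ q : ℝ × ℝ, 2 * |A| ≤ ‖q‖ → ‖Hc q‖ ≤ 2 * C / ‖q‖ ^ 4)
    (hvi : ∀ p : ℝ × ℝ, |p.2 - A| ≤ κ * E → 0 ≤ p.1 → p.1 < E → (699 / 100) * B ≤ (Hc p).2) {M m : ℕ}
    (hm : m < M) {q : ℝ × ℝ} (hqA : |q.2 - (A + m * X)| ≤ κ * E) (hq0 : 0 ≤ q.1) (hqE : q.1 < E) :
    (698 / 100) * B ≤ (hstar Hc M X q).2 := by
  have hX : 0 < X := by linarith
  have hκE : 0 ≤ κ * E := (abs_nonneg _).trans hqA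
  have hsep : ∀ n ∈ Finset.range M, (n : ℤ) ≠ (m : ℤ) → (|(n : ℝ) - (m : ℤ)| - 1 / 2) * X ≤ |q.2 - n * X| := by
    intro n _ _
    have e : q.2 - n * X = (q.2 - (A + m * X)) + A + ((m : ℝ) - n) * X := by ring
    have h1 : |((m : ℝ) - n) * X| - |q.2 - (A + m * X)| - |A| ≤ |q.2 - n * X| := by
      rw [e]
      have := abs_add_three (q.2 - (A + ↑m * X) + A + (↑m - ↑n) * X) (-(q.2 - (A + ↑m * X))) (-A)
      rw [abs_neg, abs_neg, show q.2 - (A + ↑m * X) + A + (↑m - ↑n) * X + -(q.2 - (A + ↑m * X)) + -A =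
        (↑m - ↑n) * X by ring] at this
      linarith
    rw [abs_mul, abs_of_pos hX, abs_sub_comm] at h1
    push_cast
    nlinarith
  have htail := tail_sum_le hB hC hXA hX1 hXt hdec M (m : ℤ) q hsep
  have hfilt : (Finset.range M).filter (fun n : ℕ => (n : ℤ) = (m : ℤ)) = ({m} : Finset ℕ) := by
    ext n
    simp only [Finset.mem_filter, Finset.mem_range, Finset.mem_singleton, Nat.cast_inj]
    exact ⟨fun h => h.2, fun h => ⟨h ▸ hm, h⟩⟩
  rw [hstar_snd, ← Finset.sum_filter_add_sum_filter_not (Finset.range M) (fun n : ℕ => (n : ℤ) = (m : ℤ)), hfilt,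
    Finset.sum_singleton]
  have h1 : (699 / 100) * B ≤ (Hc (q.1, q.2 - m * X)).2 :=
    hvi (q.1, q.2 - m * X) (by rw [show q.2 - ↑m * X - A = q.2 - (A + ↑m * X) by ring]; exact hqA) hq0 hqE
  have h2 : -(B / 100) ≤ ∑ n ∈ (Finset.range M).filter (fun n : ℕ => ¬((n : ℤ) = (m : ℤ))), (Hc (q.1, q.2 - n * X)).2 := by
    have : ∑ n ∈ (Finset.range M).filter (fun n : ℕ => ¬((n : ℤ) = (m : ℤ))), -‖Hc (q.1, q.2 - n * X)‖ ≤
        ∑ n ∈ (Finset.range M).filter (fun n : ℕ => ¬((n : ℤ) = (m : ℤ))), (Hc (q.1, q.2 - n * X)).2 :=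
      Finset.sum_le_sum fun n _ => by
        have := norm_snd_le (Hc (q.1, q.2 - ↑n * X)); rw [Real.norm_eq_abs] at this
        linarith [neg_abs_le (Hc (q.1, q.2 - ↑n * X)).2]
    rw [Finset.sum_neg_distrib] at this
    linarith
  linarith

/-- **§6.5 Step 4, Case 2: `|H*| ≤ M · 2C/R⁴`** when all the cluster centres are at distance `≥ R`
(`R ≥ 2|A|`; printed with `R = r/10`: `|H*(x)| ≤ 2C Σ |(x₁-nX,x₂)|⁻⁴ ≤ 2·10⁴CM/r⁴`).
[cite: Ozanski2017NSISingular, §6.5 Step 4 (Case 2)] -/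
theorem norm_hstar_le {A C R X : ℝ} (hC : 0 ≤ C) (hR : 0 < R) (hRA : 2 * |A| ≤ R)
    (hdec : ∀ q : ℝ × ℝ, 2 * |A| ≤ ‖q‖ → ‖Hc q‖ ≤ 2 * C / ‖q‖ ^ 4) {M : ℕ} {q : ℝ × ℝ}
    (hfar : ∀ n ∈ Finset.range M, R ≤ ‖(q.1, q.2 - n * X)‖) :
    ‖hstar Hc M X q‖ ≤ M * (2 * C / R ^ 4) := by
  rw [hstar]
  calc ‖∑ n ∈ Finset.range M, Hc (q.1, q.2 - n * X)‖ ≤ ∑ n ∈ Finset.range M, ‖Hc (q.1, q.2 - n * X)‖ :=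
        norm_sum_le _ _
    _ ≤ ∑ n ∈ Finset.range M, 2 * C / R ^ 4 := Finset.sum_le_sum fun n hn => by
        have h1 := hfar n hn
        calc ‖Hc (q.1, q.2 - n * X)‖ ≤ 2 * C / ‖(q.1, q.2 - n * X)‖ ^ 4 := hdec _ (hRA.trans h1)
          _ ≤ 2 * C / R ^ 4 := div_le_div_of_nonneg_left (by positivity) (by positivity)
              (pow_le_pow_left₀ hR.le h1 4)
    _ = M * (2 * C / R ^ 4) := by rw [Finset.sum_const, Finset.card_range, nsmul_eq_mul]

end Tail

/-! ### The distance to the axis under the similarities `Γ_n` -/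

section CylRadius

open Literature.Analysis.FluidPDE

/-- Local notation for physical space `ℝ³ = EuclideanSpace ℝ (Fin 3)`. -/
local notation "ℝ³" => EuclideanSpace ℝ (Fin 3)

/-- Axial translations do not change the distance to the axis. [folklore] -/
theorem cylRadius_add_smul_single_two (x : ℝ³) (c : ℝ) :
    cylRadius (x + c • EuclideanSpace.single (2 : Fin 3) (1 : ℝ)) = cylRadius x := by
  simp [cylRadius]

/-- The axial coordinate of an axial translate. [folklore] -/
theorem add_smul_single_two_apply_two (x : ℝ³) (c : ℝ) :
    (x + c • EuclideanSpace.single (2 : Fin 3) (1 : ℝ)) 2 = x 2 + c := by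
  simp

/-- **The distance to the axis of `x + w` is within `cylRadius x` of that of `w`**:
`|cylRadius (x + w) - cylRadius w| ≤ cylRadius x` (used for `R⁻¹(τR(BOX) + z) ⊆ SBOX`,
Ożański (5.21)); subadditivity of `cylRadius` as in
`Literature.Analysis.FluidPDE.SereginSverak2009.cylRadius_add_le`, reproved inline to keep the
imports light. [folklore] -/
theorem abs_cylRadius_add_sub_le (x w : ℝ³) : |cylRadius (x + w) - cylRadius w| ≤ cylRadius x := by
  -- subadditivity, from the planar Cauchy–Schwarz inequality
  have hsub : ∀ a b : ℝ³, cylRadius (a + b) ≤ cylRadius a + cylRadius b := fun a b => by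
    have ha := cylRadius_nonneg a
    have hb := cylRadius_nonneg b
    have hsa := cylRadius_sq a
    have hsb := cylRadius_sq b
    have hsab := cylRadius_sq (a + b)
    simp only [PiLp.add_apply] at hsab
    have hcs : a 0 * b 0 + a 1 * b 1 ≤ cylRadius a * cylRadius b := by
      have h1 : (a 0 * b 0 + a 1 * b 1) ^ 2 ≤ (cylRadius a * cylRadius b) ^ 2 := by
        rw [mul_pow, hsa, hsb]; nlinarith [sq_nonneg (a 0 * b 1 - a 1 * b 0)]
      have h2 : |a 0 * b 0 + a 1 * b 1| ≤ |cylRadius a * cylRadius b| := sq_le_sq.1 h1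
      rw [abs_of_nonneg (mul_nonneg ha hb)] at h2
      exact (le_abs_self _).trans h2
    have h3 : cylRadius (a + b) ^ 2 ≤ (cylRadius a + cylRadius b) ^ 2 := by
      rw [hsab]; nlinarith
    exact (pow_le_pow_iff_left₀ (cylRadius_nonneg _) (by positivity) two_ne_zero).1 h3
  have hneg : cylRadius (-x) = cylRadius x := by simp [cylRadius]
  rw [abs_le]
  constructor
  · have h := hsub (x + w) (-x)
    rw [add_neg_cancel_comm, hneg] at h
    linarith
  · have := hsub x w; linarith

end CylRadius

end Literature.Barriers.NavierStokesRegularity
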